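import Summits.CriticalPhenomena.PercolationContinuityZ3.Theorems.PercNearOneGluingNoHeavyLowerTailSahiThreeCopyOneLevel

/-!
# `NoHeavyLowerTail` (crux stmt-CriticalPhenomena-4575), Sahi programme: **THE PAIR STEP FOR A DICTATOR, BY A NON-MULTILINEAR
# POINTWISE CERTIFICATE** — `(PS)`, hence the slice law `(SC)`, when the `x₀`-free slot is a coordinate function `x_i`, the other
# two functions ARBITRARY nonnegative monotone

Support file (Sahi cell, seat `prim-sahi-p1`, generation 58; `--supports stmt-CriticalPhenomena-4575`); companion of `…SahiThreeCopyOneLevel`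
(`scx`, `PairStepLaw`), `…SliceLaw`, `…Cylinder` (`R3`).  Pure proofs; one `def` (`psK`); no `sorry`, standard axioms.

THE OBJECTS.  The free face of the one-cube (SC)-excess is `E_b(f,v,w|f,g,h) = c_b(f,v,w) + Y_b(f;g−v,h−w)` (`scx_full_left`); with
`c_b = H_b(f;vw) + R_b(f;v,w)` (`tc_eq_harris_add_R3`) this is `E = H_b(f;vw) + K_b(f; v,g; w,h)` where
`K_b(a; v,g; w,h) := R_b(a;v,w) + Y_b(a;g−v,h−w) = N(avw;1;1) − N(av;w;1) − N(aw;v;1) + N(a;v;w) + N(g−v; a(h−w); 1) + N(h−w; a(g−v); 1)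
 − N(a; g−v; h−w)` (`psK`, `scx_full_left_eq_harris_add_psK`).  NUMERICALLY (memo gen58 §7) `K_b ≥ 0` whenever `a` is a cylinder and
`v ≤ g`, `w ≤ h` are nested nonnegative monotone pairs (exhaustive d = 3 for principal `a`, 1.8·10⁶ cases; it FAILS for general monotone `a`,
and the weaker split `H(a;vw) + Y ≥ 0` fails already for `a = x₀`), which would give (PS)/(SC) for every cylinder slot.

THE THEOREM (this file): the case `a = x₀` (a DICTATOR; `glue 0 1`).  Slicing `K` along coordinate `0` (`psK_cons_*_dict`): type 0 is `0`,
type 3 is `K(1;·) = H(v¹,w¹) + N(p¹;q¹;1)` (`psK_one`), type 2 is `2H(v¹,w¹) + 2N(p¹;q¹;1)`, and type 1 is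
`H(v¹,w¹) + T`, `T := N(δv;δw;1) + N(p⁰;q¹;1) + N(p¹;q⁰;1) − N(p⁰;q⁰;1)` (`δv = v¹−v⁰`, `p^ε = g^ε − v^ε`, `q^ε = h^ε − w^ε`).
★ `T ≥ 0` (`T_nonneg`) is NOT a nonnegative combination of three-copy positivity / Harris atoms (an exact LP over 637 such atoms is
infeasible, memo §7; a degree-2 product certificate is impossible by a 6-line hand argument): it holds POINTWISE, arrangement by
arrangement, by the two-variable lemma `BB' ≤ AA' + BC' + CB'` for `0 ≤ A,B,C`, `B ≤ A + C` (and primes) — a THREE-CASE argument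
(`twoVar_le`).  This is the first inequality of the three-copy programme proved by a non-multilinear (case-split) certificate, i.e. by exactly
the kind of step the linear no-go theorems of memos gen54–57 leave open.  Consequences: `psK_dict_nonneg` (`K ≥ 0` for `a = x₀`, all profiles),
`pairStep_dict` (`0 ≤ E_b(x₀,v,w|x₀,g,h)`: the pair step for a dictator free slot), ★ `sliceLaw_dict_free`: **(SC) `2c_b(F¹,G¹,H¹) ≤ c_{(2,b)}(F,G,H)`
holds for `F = x₁` (the dictator of an OLD coordinate, so `F⁰ = F¹ = x₀` on the section cube) and ARBITRARY nonnegative monotone `G, H`** —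
the first (SC) class with an `x₀`-free first slot beyond constants.  [this work]
-/

namespace Summit.CriticalPhenomena.PercolationContinuityZ3.Theorems.SahiThreeCopy

open Finset Function Literature.Combinatorics.Sahi2008
open scoped BigOperators

noncomputable section

variable {d : ℕ}

/-! ### §1 The two-variable lemma (three cases) -/

/-- ★ **`BB' ≤ AA' + BC' + CB'`** for nonnegative reals with `B ≤ A + C`, `B' ≤ A' + C'`.  Cases: `B ≤ C` (then `BB' ≤ CB'`), `B' ≤ C'`
(then `BB' ≤ BC'`), else `(B−C)(B'−C') ≤ AA'`.  No certificate by products of the linear constraints exists (memo gen58 §7). [this work] -/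
theorem twoVar_le {A B C A' B' C' : ℝ} (hA : 0 ≤ A) (hB : 0 ≤ B) (hC : 0 ≤ C) (hA' : 0 ≤ A') (hB' : 0 ≤ B') (hC' : 0 ≤ C')
    (h : B ≤ A + C) (h' : B' ≤ A' + C') : B * B' ≤ A * A' + B * C' + C * B' := by
  rcases le_total B C with hBC | hCB
  · nlinarith [mul_le_mul_of_nonneg_right hBC hB', mul_nonneg hA hA', mul_nonneg hB hC']
  rcases le_total B' C' with hBC' | hCB'
  · nlinarith [mul_le_mul_of_nonneg_left hBC' hB, mul_nonneg hA hA', mul_nonneg hC hB']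
  · have h1 : B - C ≤ A := by linarith
    have h2 : B' - C' ≤ A' := by linarith
    have h3 : (B - C) * (B' - C') ≤ A * A' := mul_le_mul h1 h2 (sub_nonneg.2 hCB') hA
    nlinarith [mul_nonneg hC hC']

/-! ### §2 The functional `K_b = R_b + Y_b` -/

/-- `K_b(a; v,g; w,h) := R_b(a;v,w) + Y_b(a; g−v, h−w)` — the free face of the (SC)-excess minus its Harris gap `H_b(a;vw)`. [this work] -/
def psK (b : Fin d → ℕ) (a v g w h : Pt d → ℝ) : ℝ :=
  N3 b (a * v * w) 1 1 - N3 b (a * v) w 1 - N3 b (a * w) v 1 + N3 b a v w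
  + N3 b (g - v) (a * (h - w)) 1 + N3 b (h - w) (a * (g - v)) 1 - N3 b a (g - v) (h - w)

/-- **`E_b(f,v,w|f,g,h) = H_b(f;vw) + K_b(f;v,g;w,h)`**. [this work] -/
theorem scx_full_left_eq_harris_add_psK (b : Fin d → ℕ) (v w f g h : Pt d → ℝ) :
    scx b f v w f g h = (N3 b (f * v * w) 1 1 - N3 b f (v * w) 1) + psK b f v g w h := by
  rw [scx_full_left, tc_eq_harris_add_R3]
  unfold R3 psK
  ring

/-- `K_b(1; v,g; w,h) = H_b(v,w) + N_b(g−v; h−w; 1)`. [this work] -/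
theorem psK_one (b : Fin d → ℕ) (v g w h : Pt d → ℝ) :
    psK b 1 v g w h = (N3 b (v * w) 1 1 - N3 b v w 1) + N3 b (g - v) (h - w) 1 := by
  unfold psK
  simp only [one_mul]
  rw [N3_comm12 b v w 1, N3_comm13 b 1 v w, N3_comm12 b w v 1, N3_comm13 b 1 (g - v) (h - w), N3_comm12 b (h - w) (g - v) 1]
  ring

/-- Hence `K_b(1;·) ≥ 0` for monotone nonnegative `v, w` and `v ≤ g`, `w ≤ h`. [this work] -/
theorem psK_one_nonneg (b : Fin d → ℕ) {v g w h : Pt d → ℝ} (hv : ∀ x, 0 ≤ v x) (hvm : Monotone v) (hw : ∀ x, 0 ≤ w x)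
    (hwm : Monotone w) (hvg : ∀ x, v x ≤ g x) (hwh : ∀ x, w x ≤ h x) : 0 ≤ psK b 1 v g w h := by
  rw [psK_one]
  exact add_nonneg (harris3_nonneg b hv hvm hw hwm fun _ => zero_le_one)
    (N3_nonneg b (fun x => sub_nonneg.2 (hvg x)) (fun x => sub_nonneg.2 (hwh x)) fun _ => zero_le_one)

/-! ### §3 The pointwise term `T` -/

/-- ★ **`T ≥ 0`**: `0 ≤ N_b(v¹−v⁰; w¹−w⁰; 1) + N_b(g⁰−v⁰; h¹−w¹; 1) + N_b(g¹−v¹; h⁰−w⁰; 1) − N_b(g⁰−v⁰; h⁰−w⁰; 1)` whenever pointwise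
`v⁰ ≤ v¹`, `v⁰ ≤ g⁰ ≤ g¹`, `v¹ ≤ g¹` and `w⁰ ≤ w¹`, `w⁰ ≤ h⁰ ≤ h¹`, `w¹ ≤ h¹` (no monotonicity needed): arrangement by arrangement this is
`twoVar_le` with `(A,B,C) = (v¹−v⁰, g⁰−v⁰, g¹−v¹)` at one copy and `(A',B',C') = (w¹−w⁰, h⁰−w⁰, h¹−w¹)` at another. [this work] -/
theorem T_nonneg (b : Fin d → ℕ) {v₀ v₁ g₀ g₁ w₀ w₁ h₀ h₁ : Pt d → ℝ} (hv : ∀ x, v₀ x ≤ v₁ x) (hvg₀ : ∀ x, v₀ x ≤ g₀ x)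
    (hvg₁ : ∀ x, v₁ x ≤ g₁ x) (hg : ∀ x, g₀ x ≤ g₁ x) (hw : ∀ x, w₀ x ≤ w₁ x) (hwh₀ : ∀ x, w₀ x ≤ h₀ x)
    (hwh₁ : ∀ x, w₁ x ≤ h₁ x) (hh : ∀ x, h₀ x ≤ h₁ x) :
    0 ≤ N3 b (v₁ - v₀) (w₁ - w₀) 1 + N3 b (g₀ - v₀) (h₁ - w₁) 1 + N3 b (g₁ - v₁) (h₀ - w₀) 1 - N3 b (g₀ - v₀) (h₀ - w₀) 1 := by
  unfold N3
  simp only [← sum_add_distrib, ← sum_sub_distrib]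
  refine sum_nonneg fun x _ => sum_nonneg fun y _ => sum_nonneg fun z _ => ?_
  split_ifs
  · simp only [Pi.sub_apply, Pi.one_apply, mul_one]
    have key := twoVar_le (A := v₁ x - v₀ x) (B := g₀ x - v₀ x) (C := g₁ x - v₁ x) (A' := w₁ y - w₀ y) (B' := h₀ y - w₀ y)
      (C' := h₁ y - w₁ y) (sub_nonneg.2 (hv x)) (sub_nonneg.2 (hvg₀ x)) (sub_nonneg.2 (hvg₁ x)) (sub_nonneg.2 (hw y))
      (sub_nonneg.2 (hwh₀ y)) (sub_nonneg.2 (hwh₁ y)) (by linarith [hg x]) (by linarith [hh y])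
    linarith
  · simp

/-! ### §4 Slices of `K_b` for the dictator `a = x₀` -/

/-- Sections of a difference (plumbing). [this work] -/
private theorem sec_sub_dict (f g : Pt (d + 1) → ℝ) (ε : Bool) : sec (f - g) ε = sec f ε - sec g ε := rfl
/-- `N_b(f;0;h) = 0` (plumbing). [this work] -/
private theorem N3_zero_mid_dict (b : Fin d → ℕ) (f h : Pt d → ℝ) : N3 b f 0 h = 0 := by rw [N3_comm12, N3_zero_left]
/-- `N_b(1;f;g) = N_b(f;g;1)` (plumbing, atom normalisation). [this work] -/
private theorem N3_one_first_dict (b : Fin d → ℕ) (f g : Pt d → ℝ) : N3 b 1 f g = N3 b f g 1 := by rw [N3_comm12, N3_comm23]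
/-- Atom normalisation `N_b(W^s;V^t;1) = N_b(V^t;W^s;1)` for section pairs (plumbing). [this work] -/
private theorem cWV (b : Fin d → ℕ) (V W : Pt (d + 1) → ℝ) (s t : Bool) :
    N3 b (sec W s) (sec V t) 1 = N3 b (sec V t) (sec W s) 1 := N3_comm12 b _ _ 1

/-- The dictator of coordinate `0` on `{0,1}^{d+1}`: `x₀ = glue 0 1`. [this work] -/
abbrev dict0 : Pt (d + 1) → ℝ := glue (0 : Pt d → ℝ) 1

/-- `x₀ ≥ 0`. [this work] -/
theorem dict0_nonneg : ∀ x, 0 ≤ (dict0 : Pt (d + 1) → ℝ) x := glue_nonneg (fun _ => le_rfl) fun _ => zero_le_one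

/-- `x₀` is monotone. [this work] -/
theorem dict0_monotone : Monotone (dict0 : Pt (d + 1) → ℝ) := glue_monotone monotone_const monotone_const fun _ => zero_le_one

/-- Type-0 slice: `K_{(0,b)}(x₀;·) = 0`. [this work] -/
theorem psK_cons_zero_dict (b : Fin d → ℕ) (V G W H : Pt (d + 1) → ℝ) :
    psK (Fin.cons 0 b : Fin (d + 1) → ℕ) dict0 V G W H = 0 := by
  unfold psK
  simp only [N3_cons_zero, sec_mul, sec_sub_dict, sec_one, sec_glue_false, zero_mul, N3_zero_left,
    N3_zero_mid_dict]
  ring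

/-- Type-3 slice: `K_{(3,b)}(x₀;V,G;W,H) = K_b(1; V¹,G¹; W¹,H¹)`. [this work] -/
theorem psK_cons_three_dict (b : Fin d → ℕ) (V G W H : Pt (d + 1) → ℝ) :
    psK (Fin.cons 3 b : Fin (d + 1) → ℕ) dict0 V G W H =
      psK b 1 (sec V true) (sec G true) (sec W true) (sec H true) := by
  unfold psK
  simp only [N3_cons_three, sec_mul, sec_sub_dict, sec_one, sec_glue_true]

/-- ★ Type-1 slice: `K_{(1,b)}(x₀;·) = H_b(v¹,w¹) + T` with the pointwise term `T` of `T_nonneg`. [this work] -/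
theorem psK_cons_one_dict (b : Fin d → ℕ) (V G W H : Pt (d + 1) → ℝ) :
    psK (Fin.cons 1 b : Fin (d + 1) → ℕ) dict0 V G W H =
      (N3 b (sec V true * sec W true) 1 1 - N3 b (sec V true) (sec W true) 1)
      + (N3 b (sec V true - sec V false) (sec W true - sec W false) 1
          + N3 b (sec G false - sec V false) (sec H true - sec W true) 1
          + N3 b (sec G true - sec V true) (sec H false - sec W false) 1
          - N3 b (sec G false - sec V false) (sec H false - sec W false) 1) := by
  unfold psK
  simp only [N3_cons_one, sec_mul, sec_sub_dict, sec_one, sec_glue_false, sec_glue_true, zero_mul, one_mul,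
    N3_zero_left, N3_zero_mid_dict, N3_sub_left, N3_sub_mid, N3_sub_right, N3_one_first_dict,
    cWV b V W, cWV b G W, cWV b V H, cWV b G H]
  ring

/-- Type-2 slice: `K_{(2,b)}(x₀;·) = 2H_b(v¹,w¹) + 2N_b(g¹−v¹; h¹−w¹; 1)`. [this work] -/
theorem psK_cons_two_dict (b : Fin d → ℕ) (V G W H : Pt (d + 1) → ℝ) :
    psK (Fin.cons 2 b : Fin (d + 1) → ℕ) dict0 V G W H =
      2 * (N3 b (sec V true * sec W true) 1 1 - N3 b (sec V true) (sec W true) 1)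
      + 2 * N3 b (sec G true - sec V true) (sec H true - sec W true) 1 := by
  unfold psK
  simp only [N3_cons_two, sec_mul, sec_sub_dict, sec_one, sec_glue_false, sec_glue_true, zero_mul, one_mul,
    N3_zero_left, N3_zero_mid_dict, N3_sub_left, N3_sub_mid, N3_sub_right, N3_one_first_dict,
    cWV b V W, cWV b G W, cWV b V H, cWV b G H]
  ring

/-! ### §5 `K ≥ 0` for a dictator; the pair step and the slice law for a dictator slot -/

/-- ★ **`K_B(x₀; V,G; W,H) ≥ 0`** at EVERY profile `B` of `{0,1}^{d+1}`, for nonnegative monotone `V ≤ G`, `W ≤ H`. [this work] -/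
theorem psK_dict_nonneg (B : Fin (d + 1) → ℕ) {V G W H : Pt (d + 1) → ℝ} (hV : ∀ x, 0 ≤ V x) (hW : ∀ x, 0 ≤ W x)
    (hVm : Monotone V) (hGm : Monotone G) (hWm : Monotone W) (hHm : Monotone H) (hVG : ∀ x, V x ≤ G x) (hWH : ∀ x, W x ≤ H x) :
    0 ≤ psK B dict0 V G W H := by
  have hB : B = Fin.cons (B 0) (Fin.tail B) := (Fin.cons_self_tail B).symm
  set b := Fin.tail B
  have v1n := sec_nonneg hV true; have w1n := sec_nonneg hW true
  have v1m := sec_monotone hVm true; have w1m := sec_monotone hWm true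
  have Hv : 0 ≤ N3 b (sec V true * sec W true) 1 1 - N3 b (sec V true) (sec W true) 1 :=
    harris3_nonneg b v1n v1m w1n w1m fun _ => zero_le_one
  have hvg : ∀ ε x, sec V ε x ≤ sec G ε x := fun ε x => hVG _
  have hwh : ∀ ε x, sec W ε x ≤ sec H ε x := fun ε x => hWH _
  rw [hB]
  match hk : B 0 with
  | 0 => rw [psK_cons_zero_dict]
  | 1 =>
    rw [psK_cons_one_dict]
    exact add_nonneg Hv (T_nonneg b (sec_false_le_sec_true hVm) (hvg false) (hvg true) (sec_false_le_sec_true hGm)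
      (sec_false_le_sec_true hWm) (hwh false) (hwh true) (sec_false_le_sec_true hHm))
  | 2 =>
    rw [psK_cons_two_dict]
    have := N3_nonneg b (f := sec G true - sec V true) (g := sec H true - sec W true) (h := 1)
      (fun x => sub_nonneg.2 (hvg true x)) (fun x => sub_nonneg.2 (hwh true x)) fun _ => zero_le_one
    nlinarith
  | 3 =>
    rw [psK_cons_three_dict]
    exact psK_one_nonneg b v1n v1m w1n w1m (hvg true) (hwh true)
  | k + 4 =>
    unfold psK
    simp only [N3_cons_add_four]
    norm_num

/-- ★ **THE PAIR STEP FOR A DICTATOR**: `0 ≤ E_B(x₀, V, W | x₀, G, H)` on `{0,1}^{d+1}` for nonnegative monotone `V ≤ G`, `W ≤ H` — the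
instance `f = x₀` of `PairStepLaw`. [this work] -/
theorem pairStep_dict (B : Fin (d + 1) → ℕ) {V G W H : Pt (d + 1) → ℝ} (hV : ∀ x, 0 ≤ V x) (hW : ∀ x, 0 ≤ W x)
    (hVm : Monotone V) (hGm : Monotone G) (hWm : Monotone W) (hHm : Monotone H) (hVG : ∀ x, V x ≤ G x) (hWH : ∀ x, W x ≤ H x) :
    0 ≤ scx B dict0 V W dict0 G H := by
  rw [scx_full_left_eq_harris_add_psK]
  refine add_nonneg ?_ (psK_dict_nonneg B hV hW hVm hGm hWm hHm hVG hWH)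
  have h := N3_le_N3_mul (d + 1) B dict0 (V * W) 1 dict0_nonneg dict0_monotone (fun x => mul_nonneg (hV x) (hW x))
    (hVm.mul hWm hV hW) fun _ => zero_le_one
  rw [← mul_assoc] at h
  exact sub_nonneg.2 h

/-- ★ **(SC) FOR A DICTATOR SLOT**: for `F = x₁` on `{0,1}^{d+2}` (the dictator of the first OLD coordinate, `F = x₀ ∘ tail`, so that
both sections of `F` along the sliced coordinate are the dictator `x₀` of `{0,1}^{d+1}`) and ARBITRARY nonnegative monotone `G, H`:
`2·c_B(F¹,G¹,H¹) ≤ c_{(2,B)}(F,G,H)`. [this work] -/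
theorem sliceLaw_dict_free (B : Fin (d + 1) → ℕ) {G H : Pt (d + 2) → ℝ} (hG : ∀ x, 0 ≤ G x) (hH : ∀ x, 0 ≤ H x)
    (hGm : Monotone G) (hHm : Monotone H) :
    2 * tc B (sec (fun x : Pt (d + 2) => (dict0 : Pt (d + 1) → ℝ) (Fin.tail x)) true) (sec G true) (sec H true) ≤
      tc (Fin.cons 2 B : Fin (d + 2) → ℕ) (fun x => (dict0 : Pt (d + 1) → ℝ) (Fin.tail x)) G H := by
  have hs : ∀ ε : Bool, sec (fun x : Pt (d + 2) => (dict0 : Pt (d + 1) → ℝ) (Fin.tail x)) ε = dict0 := by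
    intro ε; funext x; simp [sec, Fin.tail_cons]
  have e := tc_cons_two_sub_two_eq_scx B (fun x : Pt (d + 2) => (dict0 : Pt (d + 1) → ℝ) (Fin.tail x)) G H
  rw [hs, hs] at e
  have key := pairStep_dict B (V := sec G false) (G := sec G true) (W := sec H false) (H := sec H true)
    (sec_nonneg hG false) (sec_nonneg hH false) (sec_monotone hGm false) (sec_monotone hGm true) (sec_monotone hHm false)
    (sec_monotone hHm true) (sec_false_le_sec_true hGm) (sec_false_le_sec_true hHm)
  rw [hs] -- in the goal
  linarith

end

end Summit.CriticalPhenomena.PercolationContinuityZ3.Theorems.SahiThreeCopy
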